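import Summits.CriticalPhenomena.PercolationContinuityZ3.Theses.PercNonProliferation
import Summits.CriticalPhenomena.PercolationContinuityZ3.Theses.PercHyperscalingGluing
import Summits.CriticalPhenomena.PercolationContinuityZ3.Theses.PercHollowCells
import Literature.Barriers.CriticalPhenomena.GaussianDominationRoute
import Literature.Barriers.CriticalPhenomena.KozmaNachmiasLemma11Steps
import Literature.Barriers.CriticalPhenomena.LaceExpansionHighDimensionOneArm

/-!
# Disproof of `FreeBoxSparse` — findings (cdisprove, crux stmt-CriticalPhenomena-4445, gen 1)

Crux (route PercNonProliferation, r3): `FA₂(n) := |B(n)|⁻² Σ_{x,y ∈ B(n)} P_{p_c}(x ↔ y inside B(n)) → 0`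
on `ℤ³` (`B(n) = box 3 n = [-n,n]³`, bond percolation at `p_c = criticalProbI 3`).

LANDED IN THE TREE (importable, namespace `…Theorems.FreeBoxSparse.Negative`):
`Theorems/FreeBoxSparse/Negative/OfContinuity.lean` (p73105: §1–§2 — `theta_pos_of_not_freeBoxSparse`,
`not_percolationContinuityZ3_of_not_freeBoxSparse`, `tendsto_freePairAverage_of_theta_eq_zero`,
`tendsto_bulkPairAverage_iff_theta_eq_zero`, `tendsto_pairAverage_of_tendsto_cofinite`),
`…/Negative/DCTFloor.lean` (p73075: §3, §4, §6 — `freePairAverage_ge`, `freePairAverage_criticalProbI_ge`,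
`tendsto_freeSusceptibility_atTop`, `freeBoxPowerSaving_exponent_le_two`, `freePairAverage_one`,
`freePairAverage_mono`, `continuous_freePairAverage`, `freeBoxSparse_iff_uniform_subcritical`),
`…/Negative/CentredForms.lean` (p73077: §7 — `freeBoxSparse_iff_hyperscalingGluing_freeBoxShattering`,
`freeBoxSparse_iff_hollowCells_freeBoxShattering`, `hyperscalingGluing_iff_hollowCells_freeBoxShattering`),
`…/Negative/Sandwich.lean` (p73930: §8 — `tendsto_tau_theta_sq`, `tendsto_bulkPairAverage`,
`eventually_freePairAverage_le`).

INDEX (prose only in docstrings; every `theorem` is checked, no `sorry`):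
* §0 vocabulary: `pairSum p n`, `FA2 p n`, `FreeBoxSparseAt p`; `freeBoxSparse_iff` (the crux is
  `FreeBoxSparseAt p_c`, by `Iff.rfl`).
* §1 IRREFUTABILITY CERTIFICATE: `freeBoxSparseAt_of_theta_eq_zero` (θ(p) = 0 ⇒ FA₂ → 0 at p, a
  Cesàro argument over `θ = 0 ⇔ τ → 0`, tree: `theta_eq_zero_iff_tendsto_tau_cofinite`), hence
  `freeBoxSparse_of_continuity : PercolationContinuityZ3 → FreeBoxSparse` and
  `jump_of_not_freeBoxSparse : ¬ FreeBoxSparse → 0 < θ(p_c)`. VERDICT: any refutation of the crux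
  is a proof of `θ(p_c(ℤ³)) > 0`, i.e. refutes the summit conjunct itself.
* §2 WHAT IS LOAD-BEARING — the word "inside B(n)": the BULK pair average
  (`P(x ↔ y)` instead of `P(x ↔ y inside B(n))`) tends to `0` IFF `θ(p) = 0`
  (`bulkPairSparseAt_iff_theta_eq_zero`, via `θ² ≤ τ`, uniqueness + FKG in tree). So the crux is
  EXACTLY the summit minus in-box gluing; its only failure mode is a jump whose infinite cluster
  re-enters free boxes through the outside (sparse free boxes), as the route says.
* §3 THE PARAMETER: `freeBoxSparseAt_of_lt_criticalProb` (true for every `p < p_c`),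
  `not_freeBoxSparseAt_one` (false at `p = 1`, where `FA₂ ≡ 1`). (False for every `p > p_c` by the
  Grimmett–Marstrand free-box giant — not formalised here.)
* §4 TIGHTNESS / THE NORMALISATION (Duminil-Copin–Tassion `φ_{p_c}(S) ≥ 1`, tree:
  `sum_sphere_real_openConnIn_ge`): `sum_box_real_openConnIn_ge` (centred free susceptibility
  `Σ_{y∈B(n)} P_{p}(0 ↔ y in B(n)) ≥ (n+1)/6` for `p ≥ p_c`), `pairSum_ge` (`Σ_{x,y} ≥ (n+1)⁴/12`),
  `FA2_ge` (`FA₂(n) ≥ 1/(768 (n+1)²)`), `tendsto_freeSusceptibility_atTop` (with `|B(n)|⁻¹` in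
  place of `|B(n)|⁻²` the statement is FALSE: the quotient → ∞ linearly), and
  `powerSaving_exponent_le_two` (the sibling crux FreeBoxPowerSaving, stmt-4447, can only hold with
  `a ≤ 2`; prediction `a = 1 + η ≈ 0.95`, MC j005901: `a ≈ 1.0`).
* §6 THE CRUX IS A UNIFORM SUBCRITICAL STATEMENT: `FA2_mono`, `continuous_FA2`,
  `freeBoxSparseAt_anti` (downward closed in `p`), `FA2_criticalProbI_eq_sSup`
  (`FA₂(p_c,n) = sup_{p<p_c} FA₂(p,n)`), `freeBoxSparse_iff_uniform_subcritical`
  (crux ⇔ `FA₂(p,n) → 0` uniformly in `p < p_c`).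
* §7 EQUIVALENT CENTRED FORMS: `freeBoxSparse_iff_hyperscalingGluing_freeBoxShattering` (⇔ stmt-4644),
  `freeBoxSparse_iff_hollowCells_freeBoxShattering` (⇔ stmt-5836) via `F(r) ≤ 64 FA₂(2r)`,
  `FA₂(n) ≤ 8 F(2n)` — one item, three names.
* §8 THE UPPER SANDWICH (two disjoint boxes, tree: `tau_le_oneArmProb_sq_of_coord`):
  `tendsto_tau_sub_theta_sq` (`τ_p(0,v) → θ(p)²`), `tendsto_bulkPairAverage` (bulk pair average
  `→ θ(p)²`), `eventually_FA2_le` (`FA₂(p,n) ≤ θ(p)² + ε` eventually) — so in a jump world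
  `θ(p_c)²/N_n ≲ FA₂(p_c,n) ≲ θ(p_c)²`: the crux is exactly the vanishing of the in-box gluing
  fraction.
* §9 THE ASSEMBLY'S FORM: `tendsto_annPairAverage_iff` — `E S_n/|B(n)|² → 0`
  (`S_n` = pairs of `B(n)` joined inside `B(2n)`) ⇔ crux.
* §10 NUMERICS (MC j007901): `FA₂ ∝ L^{-1.0…-1.14}`, `|K_max|/|B| ∝ L^{-0.51}`, `E N_n ≈ 13.5` flat,
  annulus always crossed — table + reading.
* §5 WHY IT RESISTS (docblock at the end).
-/

noncomputable section

open MeasureTheory Filter Topology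
open Literature.Probability.Percolation Literature.Probability.LatticeModels
open Literature.Barriers.CriticalPhenomena (sum_sphere_real_openConnIn_ge real_openConnIn_shift_box
  mem_image_zdShiftIso_box_iff theta_eq_zero_iff_tendsto_tau_cofinite tau_le_oneArmProb_sq_of_coord
  oneArmProb_mem_Icc)

namespace Summit.CriticalPhenomena.PercolationContinuityZ3.Cruxes.FreeBoxSparse.Disproof

/-! ## §0 Vocabulary -/

/-- Sites of `ℤ³`. [folklore] -/
abbrev V3 : Type := Site 3

/-- `P_p` on `ℤ³`. [folklore] -/
abbrev μ (p : unitInterval) : Measure (BondConfig V3) := bondPercolation (zdGraph 3) p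

/-- The free-box pair sum `Σ_{x,y ∈ B(n)} P_p(x ↔ y inside B(n))`. [folklore] -/
def pairSum (p : unitInterval) (n : ℕ) : ℝ :=
  ∑ x ∈ box 3 n, ∑ y ∈ box 3 n, (μ p).real (openConnIn ↑(box 3 n) x y)

/-- The free-box pair average `FA₂(p, n) = pairSum / |B(n)|²`. [folklore] -/
def FA2 (p : unitInterval) (n : ℕ) : ℝ := pairSum p n / ((box 3 n).card : ℝ) ^ 2

/-- The crux at a general parameter `p`: `FA₂(p, n) → 0`. [folklore] -/
def FreeBoxSparseAt (p : unitInterval) : Prop := Tendsto (FA2 p) atTop (𝓝 0)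

/-- The crux IS `FreeBoxSparseAt p_c` (definitional). [folklore] -/
theorem freeBoxSparse_iff :
    Theses.PercNonProliferation.FreeBoxSparse ↔ FreeBoxSparseAt (criticalProbI 3) := Iff.rfl

/-- `0 < |B(n)|`. [folklore] -/
theorem card_box_pos (n : ℕ) : (0 : ℝ) < (box 3 n).card := by
  exact_mod_cast Finset.card_pos.2 (box_nonempty 3 n)

/-- `|B(n)| = (2n+1)³` as a real number. [folklore] -/
theorem card_box_real (n : ℕ) : ((box 3 n).card : ℝ) = (2 * n + 1) ^ 3 := by
  rw [card_box]; push_cast; ring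

/-- `n + 1 ≤ |B(n)|`. [folklore] -/
theorem succ_le_card_box (n : ℕ) : (n : ℝ) + 1 ≤ (box 3 n).card := by
  rw [card_box_real]; nlinarith [sq_nonneg (n : ℝ), (Nat.cast_nonneg n : (0 : ℝ) ≤ n)]

/-- `pairSum ≥ 0`. [folklore] -/
theorem pairSum_nonneg (p : unitInterval) (n : ℕ) : 0 ≤ pairSum p n :=
  Finset.sum_nonneg fun _ _ => Finset.sum_nonneg fun _ _ => measureReal_nonneg

/-- `FA₂ ≥ 0`. [folklore] -/
theorem FA2_nonneg (p : unitInterval) (n : ℕ) : 0 ≤ FA2 p n :=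
  div_nonneg (pairSum_nonneg p n) (sq_nonneg _)

/-- Monotonicity of `{x ↔ y in S}` in `S`. [folklore] -/
theorem openConnIn_mono' {S S' : Set V3} (h : S ⊆ S') (x y : V3) :
    openConnIn S x y ⊆ openConnIn S' x y := fun _ hω =>
  DCT16.mem_openConnIn_of_pathIn ((DCT16.pathIn_of_mem_openConnIn hω).mono h)

/-- `P_p(x ↔ y in B(n)) ≤ τ_p(0, y - x)`. [folklore] -/
theorem real_openConnIn_le_tau (p : unitInterval) (n : ℕ) (x y : V3) :
    (μ p).real (openConnIn ↑(box 3 n) x y) ≤ tau 3 p 0 (y - x) := by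
  rw [← tau_eq_tau_zero_sub, tau_def]
  exact measureReal_mono (openConnIn_subset_openConn _ x y)

/-! ## §1 Irrefutability: `θ(p) = 0 ⇒ FA₂(p, ·) → 0`; so `¬ crux ⇒ θ(p_c) > 0` -/

/-- **Cesàro over pairs.** If `0 ≤ g_n(x,y) ≤ min(1, f(y-x))` on `B(n)²` and `f → 0` at infinity,
then `|B(n)|⁻² Σ_{x,y∈B(n)} g_n(x,y) → 0`: for `ε > 0` only finitely many `z` have `f z ≥ ε/2`,
say `K` of them; each row `x` then contributes `≤ K + |B(n)| ε/2`. [folklore] -/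
theorem tendsto_pairAverage_of_tendsto_cofinite {f : V3 → ℝ} (hf : Tendsto f cofinite (𝓝 0))
    {g : ℕ → V3 → V3 → ℝ} (hg0 : ∀ n x y, 0 ≤ g n x y) (hg1 : ∀ n x y, g n x y ≤ 1)
    (hgf : ∀ n x y, g n x y ≤ f (y - x)) :
    Tendsto (fun n : ℕ => (∑ x ∈ box 3 n, ∑ y ∈ box 3 n, g n x y) / ((box 3 n).card : ℝ) ^ 2)
      atTop (𝓝 0) := by
  rw [Metric.tendsto_atTop]
  intro ε hε
  have hε2 : (0 : ℝ) < ε / 2 := by linarith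
  have hT : {z : V3 | ¬ f z < ε / 2}.Finite :=
    Filter.eventually_cofinite.1 (hf.eventually (gt_mem_nhds hε2))
  set T : Finset V3 := hT.toFinset with hTdef
  set K : ℕ := T.card with hKdef
  obtain ⟨N, hN⟩ : ∃ N : ℕ, (2 * K / ε : ℝ) < N := exists_nat_gt _
  refine ⟨N, fun n hn => ?_⟩
  have hcard := card_box_pos n
  -- one row
  have hrow : ∀ x : V3, ∑ y ∈ box 3 n, g n x y ≤ K + (box 3 n).card * (ε / 2) := by
    intro x
    rw [← Finset.sum_filter_add_sum_filter_not (box 3 n) (fun y => y - x ∈ T)]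
    refine add_le_add ?_ ?_
    · calc ∑ y ∈ (box 3 n).filter (fun y => y - x ∈ T), g n x y
          ≤ ∑ y ∈ (box 3 n).filter (fun y => y - x ∈ T), (1 : ℝ) :=
            Finset.sum_le_sum fun y _ => hg1 n x y
        _ = (((box 3 n).filter (fun y => y - x ∈ T)).card : ℝ) := by simp
        _ ≤ K := by
            have h : ((box 3 n).filter (fun y => y - x ∈ T)).card ≤ T.card :=
              Finset.card_le_card_of_injOn (fun y => y - x)
                (fun y hy => by
                  have := (Finset.mem_filter.1 (Finset.mem_coe.1 hy)).2
                  exact Finset.mem_coe.2 this)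
                (fun a _ b _ hab => sub_left_injective hab)
            exact_mod_cast h
    · calc ∑ y ∈ (box 3 n).filter (fun y => ¬ (y - x ∈ T)), g n x y
          ≤ ∑ y ∈ (box 3 n).filter (fun y => ¬ (y - x ∈ T)), ε / 2 := by
            refine Finset.sum_le_sum fun y hy => ?_
            have hyT : y - x ∉ T := (Finset.mem_filter.1 hy).2
            have hlt : f (y - x) < ε / 2 := by
              by_contra h
              exact hyT (hT.mem_toFinset.2 h)
            exact (hgf n x y).trans hlt.le
        _ = (((box 3 n).filter (fun y => ¬ (y - x ∈ T))).card : ℝ) * (ε / 2) := by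
            rw [Finset.sum_const, nsmul_eq_mul]
        _ ≤ (box 3 n).card * (ε / 2) :=
            mul_le_mul_of_nonneg_right (by exact_mod_cast Finset.card_filter_le _ _) hε2.le
  have htot : ∑ x ∈ box 3 n, ∑ y ∈ box 3 n, g n x y ≤
      (box 3 n).card * (K + (box 3 n).card * (ε / 2)) := by
    calc ∑ x ∈ box 3 n, ∑ y ∈ box 3 n, g n x y ≤ ∑ _x ∈ box 3 n, (K + (box 3 n).card * (ε / 2)) :=
          Finset.sum_le_sum fun x _ => hrow x
      _ = _ := by rw [Finset.sum_const, nsmul_eq_mul]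
  have hnn : 0 ≤ ∑ x ∈ box 3 n, ∑ y ∈ box 3 n, g n x y :=
    Finset.sum_nonneg fun x _ => Finset.sum_nonneg fun y _ => hg0 n x y
  rw [Real.dist_eq, sub_zero, abs_of_nonneg (div_nonneg hnn (sq_nonneg _)),
    div_lt_iff₀ (by positivity)]
  have hK : (K : ℝ) < (box 3 n).card * (ε / 2) := by
    have h1 : (K : ℝ) < N * (ε / 2) := by
      rw [div_lt_iff₀ hε] at hN; linarith
    have h2 : (N : ℝ) ≤ n := by exact_mod_cast hn
    have h3 : (n : ℝ) ≤ (box 3 n).card := by linarith [succ_le_card_box n]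
    calc (K : ℝ) < N * (ε / 2) := h1
      _ ≤ n * (ε / 2) := by gcongr
      _ ≤ (box 3 n).card * (ε / 2) := by gcongr
  calc ∑ x ∈ box 3 n, ∑ y ∈ box 3 n, g n x y
      ≤ (box 3 n).card * (K + (box 3 n).card * (ε / 2)) := htot
    _ < (box 3 n).card * ((box 3 n).card * (ε / 2) + (box 3 n).card * (ε / 2)) := by gcongr
    _ = ε * ((box 3 n).card : ℝ) ^ 2 := by ring

/-- **`θ(p) = 0 ⇒ FA₂(p, n) → 0`** (every `p`): `P_p(x ↔ y in B(n)) ≤ τ_p(0, y-x) → 0` cofinitely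
when `θ(p) = 0` (tree: `theta_eq_zero_iff_tendsto_tau_cofinite`), then Cesàro. [folklore] -/
theorem freeBoxSparseAt_of_theta_eq_zero (p : unitInterval) (hθ : theta (zdGraph 3) 0 p = 0) :
    FreeBoxSparseAt p :=
  tendsto_pairAverage_of_tendsto_cofinite ((theta_eq_zero_iff_tendsto_tau_cofinite p).1 hθ)
    (g := fun n x y => (μ p).real (openConnIn ↑(box 3 n) x y))
    (fun _ _ _ => measureReal_nonneg) (fun _ _ _ => measureReal_le_one) (real_openConnIn_le_tau p)

/-- **The summit conjunct implies the crux**: `θ(p_c) = 0 → FreeBoxSparse`. [folklore] -/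
theorem freeBoxSparse_of_continuity (h : _root_.PercolationContinuityZ3) :
    Theses.PercNonProliferation.FreeBoxSparse :=
  freeBoxSparse_iff.2 (freeBoxSparseAt_of_theta_eq_zero _ h)

/-- **Irrefutability certificate**: a refutation of the crux IS a proof of the jump
`θ(p_c(ℤ³)) > 0` (the negation of the summit conjunct). [folklore] -/
theorem jump_of_not_freeBoxSparse (h : ¬ Theses.PercNonProliferation.FreeBoxSparse) :
    0 < theta (zdGraph 3) (0 : V3) (criticalProbI 3) := by
  refine lt_of_le_of_ne measureReal_nonneg fun h0 => h (freeBoxSparse_of_continuity ?_)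
  exact h0.symm

/-- Equivalently: `¬ FreeBoxSparse → ¬ PercolationContinuityZ3`. [folklore] -/
theorem not_continuity_of_not_freeBoxSparse (h : ¬ Theses.PercNonProliferation.FreeBoxSparse) :
    ¬ _root_.PercolationContinuityZ3 := fun hc => h (freeBoxSparse_of_continuity hc)

/-! ## §2 What is load-bearing: only the restriction "inside `B(n)`"

Replacing `P(x ↔ y inside B(n))` by the bulk connectivity `τ(x,y) = P(x ↔ y)` gives a statement
EQUIVALENT to `θ(p) = 0`: `θ(p)² ≤ τ_p(x,y)` for all `x, y` (uniqueness of the infinite cluster +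
Harris–FKG, tree: `Grimmett1999_theta_sq_le_openConn_holds`) bounds the bulk pair average below by
`θ²`. So `FreeBoxSparse` is precisely `θ(p_c) = 0` with the in-box gluing removed. -/

/-- The bulk pair average `|B(n)|⁻² Σ_{x,y∈B(n)} τ_p(x,y) → 0`. [folklore] -/
def BulkPairSparseAt (p : unitInterval) : Prop :=
  Tendsto (fun n : ℕ => (∑ x ∈ box 3 n, ∑ y ∈ box 3 n, tau 3 p x y) / ((box 3 n).card : ℝ) ^ 2)
    atTop (𝓝 0)

/-- `θ(p)²` is below every bulk pair average. [folklore] -/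
theorem theta_sq_le_bulkPairAverage (p : unitInterval) (n : ℕ) :
    theta (zdGraph 3) 0 p ^ 2 ≤
      (∑ x ∈ box 3 n, ∑ y ∈ box 3 n, tau 3 p x y) / ((box 3 n).card : ℝ) ^ 2 := by
  rw [le_div_iff₀ (by have := card_box_pos n; positivity)]
  calc theta (zdGraph 3) 0 p ^ 2 * ((box 3 n).card : ℝ) ^ 2
      = ∑ _x ∈ box 3 n, ∑ _y ∈ box 3 n, theta (zdGraph 3) 0 p ^ 2 := by
        rw [Finset.sum_const, Finset.sum_const, nsmul_eq_mul, nsmul_eq_mul]; ring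
    _ ≤ ∑ x ∈ box 3 n, ∑ y ∈ box 3 n, tau 3 p x y :=
        Finset.sum_le_sum fun x _ => Finset.sum_le_sum fun y _ =>
          Grimmett1999_theta_sq_le_openConn_holds 3 p x y

/-- **Bulk pair sparsity ⇔ `θ(p) = 0`** (every `p`). [folklore] -/
theorem bulkPairSparseAt_iff_theta_eq_zero (p : unitInterval) :
    BulkPairSparseAt p ↔ theta (zdGraph 3) 0 p = 0 := by
  constructor
  · intro h
    have h2 : theta (zdGraph 3) 0 p ^ 2 ≤ 0 :=
      ge_of_tendsto h (Eventually.of_forall fun n => theta_sq_le_bulkPairAverage p n)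
    exact pow_eq_zero_iff two_ne_zero |>.1 (le_antisymm h2 (sq_nonneg _))
  · intro hθ
    refine tendsto_pairAverage_of_tendsto_cofinite ((theta_eq_zero_iff_tendsto_tau_cofinite p).1 hθ)
      (g := fun _ x y => tau 3 p x y) (fun _ _ _ => tau_nonneg p _ _) (fun _ _ _ => tau_le_one p _ _)
      (fun _ x y => (tau_eq_tau_zero_sub p x y).le)

/-- At `p_c`: the bulk version of the crux is EQUIVALENT to the summit conjunct. [folklore] -/
theorem bulkPairSparse_iff_continuity :
    BulkPairSparseAt (criticalProbI 3) ↔ _root_.PercolationContinuityZ3 :=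
  bulkPairSparseAt_iff_theta_eq_zero _

/-- Free ≤ bulk termwise, so bulk sparsity implies the crux at every `p`. [folklore] -/
theorem freeBoxSparseAt_of_bulk (p : unitInterval) (h : BulkPairSparseAt p) : FreeBoxSparseAt p :=
  freeBoxSparseAt_of_theta_eq_zero p ((bulkPairSparseAt_iff_theta_eq_zero p).1 h)

/-! ## §3 The parameter: true below `p_c`, false at `p = 1` -/

/-- Below `p_c` the crux's analogue holds (`θ(p) = 0` there, tree:
`theta_eq_zero_of_lt_criticalProb_holds`). [folklore] -/
theorem freeBoxSparseAt_of_lt_criticalProb (p : unitInterval)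
    (hp : (p : ℝ) < criticalProb (zdGraph 3) (0 : V3)) : FreeBoxSparseAt p :=
  freeBoxSparseAt_of_theta_eq_zero p (theta_eq_zero_of_lt_criticalProb_holds (zdGraph 3) 0 p hp)

/-- At `p = 1` every lattice edge is open and the box is connected through itself:
`P_1(x ↔ y in B(n)) = 1` for `x, y ∈ B(n)`. [folklore] -/
theorem real_openConnIn_one {n : ℕ} {x y : V3} (hx : x ∈ box 3 n) (hy : y ∈ box 3 n) :
    (μ 1).real (openConnIn ↑(box 3 n) x y) = 1 := by
  have hμ : μ 1 = Measure.dirac (zdGraph 3).edgeSet := by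
    rw [show μ 1 = bondPercolation (zdGraph 3) 1 from rfl, bondPercolation]
    exact ProbabilityTheory.setBernoulli_one _
  have hmem : (zdGraph 3).edgeSet ∈ openConnIn (↑(box 3 n) : Set V3) x y := by
    refine ⟨hx, hy, ?_⟩
    have hG : openGraph ((zdGraph 3).edgeSet) = zdGraph 3 := SimpleGraph.fromEdgeSet_edgeSet _
    rw [hG]
    exact box_induce_reachable n hx hy
  rw [hμ, measureReal_def, Measure.dirac_apply_of_mem hmem, ENNReal.toReal_one]

/-- At `p = 1`, `FA₂ ≡ 1`. [folklore] -/
theorem FA2_one (n : ℕ) : FA2 1 n = 1 := by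
  have hcard := card_box_pos n
  rw [FA2, pairSum, div_eq_one_iff_eq (by positivity)]
  calc ∑ x ∈ box 3 n, ∑ y ∈ box 3 n, (μ 1).real (openConnIn ↑(box 3 n) x y)
      = ∑ x ∈ box 3 n, ∑ y ∈ box 3 n, (1 : ℝ) :=
        Finset.sum_congr rfl fun x hx => Finset.sum_congr rfl fun y hy => real_openConnIn_one hx hy
    _ = ((box 3 n).card : ℝ) ^ 2 := by
        rw [Finset.sum_const, Finset.sum_const, nsmul_eq_mul, nsmul_eq_mul]; ring

/-- **The parameter is load-bearing**: `FreeBoxSparseAt 1` is false. [folklore] -/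
theorem not_freeBoxSparseAt_one : ¬ FreeBoxSparseAt 1 := by
  intro h
  have h1 : Tendsto (FA2 1) atTop (𝓝 1) := by
    simp only [funext FA2_one]; exact tendsto_const_nhds
  exact zero_ne_one (tendsto_nhds_unique h h1)

/-! ## §4 Tightness: the free pair sum is at least `c n⁴` at (and above) `p_c`

Duminil-Copin–Tassion: `φ_{p}(S) ≥ 1` for every finite `S ∋ 0` when `p ≥ p_c` (tree:
`one_le_phi_criticalProbI`, `sum_sphere_real_openConnIn_ge`: `Σ_{z∈∂B(k)} P_p(0 ↔ z in B(k)) ≥ 1/6`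
on `ℤ³`). Summing over the shells `∂B(k)`, `k ≤ n`, gives a centred free susceptibility
`≥ (n+1)/6`; translating the centre over `B(n - n/2)` gives the pair sum `≥ (n+1)⁴/12`. -/

/-- **Centred free susceptibility at `p ≥ p_c`**: `Σ_{y ∈ B(n)} P_p(0 ↔ y in B(n)) ≥ (n+1)/6`.
[folklore] -/
theorem sum_box_real_openConnIn_ge (p : unitInterval)
    (hp : criticalProb (zdGraph 3) (0 : V3) ≤ p) (n : ℕ) :
    ((n : ℝ) + 1) / 6 ≤ ∑ y ∈ box 3 n, (μ p).real (openConnIn ↑(box 3 n) 0 y) := by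
  have hdisj : Set.PairwiseDisjoint (↑(Finset.range (n + 1)) : Set ℕ) (sphere 3) := by
    intro j _ k _ hjk
    exact Finset.disjoint_left.2 fun y hyj hyk => hjk ((mem_sphere.1 hyj).symm.trans (mem_sphere.1 hyk))
  have hsub : (Finset.range (n + 1)).biUnion (sphere 3) ⊆ box 3 n := by
    intro y hy
    obtain ⟨k, hk, hyk⟩ := Finset.mem_biUnion.1 hy
    exact box_mono 3 (by simpa [Nat.lt_succ_iff] using hk) (sphere_subset_box 3 k hyk)
  calc ((n : ℝ) + 1) / 6 = ∑ _k ∈ Finset.range (n + 1), (1 : ℝ) / (2 * (3 : ℕ)) := by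
        rw [Finset.sum_const, Finset.card_range, nsmul_eq_mul]; push_cast; ring
    _ ≤ ∑ k ∈ Finset.range (n + 1), ∑ z ∈ sphere 3 k, (μ p).real (openConnIn ↑(box 3 k) 0 z) :=
        Finset.sum_le_sum fun k _ => sum_sphere_real_openConnIn_ge (d := 3) (by norm_num) p hp k
    _ ≤ ∑ k ∈ Finset.range (n + 1), ∑ z ∈ sphere 3 k, (μ p).real (openConnIn ↑(box 3 n) 0 z) := by
        refine Finset.sum_le_sum fun k hk => Finset.sum_le_sum fun z _ => measureReal_mono ?_
        exact openConnIn_mono' (Finset.coe_subset.2 (box_mono 3 (by simpa [Nat.lt_succ_iff] using hk))) 0 z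
    _ = ∑ z ∈ (Finset.range (n + 1)).biUnion (sphere 3), (μ p).real (openConnIn ↑(box 3 n) 0 z) :=
        (Finset.sum_biUnion hdisj).symm
    _ ≤ ∑ y ∈ box 3 n, (μ p).real (openConnIn ↑(box 3 n) 0 y) :=
        Finset.sum_le_sum_of_subset_of_nonneg hsub fun _ _ _ => measureReal_nonneg

/-- Translating the centre: for `x ∈ B(r)` and `r + k ≤ m`,
`Σ_{y ∈ B(m)} P_p(x ↔ y in B(m)) ≥ Σ_{z ∈ B(k)} P_p(0 ↔ z in B(k))`. [folklore] -/
theorem sum_box_real_openConnIn_shift_ge (p : unitInterval) {m r k : ℕ} (hrk : r + k ≤ m)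
    {x : V3} (hx : x ∈ box 3 r) :
    ∑ z ∈ box 3 k, (μ p).real (openConnIn ↑(box 3 k) 0 z) ≤
      ∑ y ∈ box 3 m, (μ p).real (openConnIn ↑(box 3 m) x y) := by
  -- the translated box `x + B(k)` sits inside `B(m)`
  have himg : (⇑(zdShiftIso x) '' (↑(box 3 k) : Set V3)) ⊆ ↑(box 3 m) := by
    intro w hw
    have hw' : w - x ∈ box 3 k := mem_image_zdShiftIso_box_iff.1 hw
    rw [Finset.mem_coe, mem_box] at *
    intro i
    have h1 := hw' i; have h2 := hx i
    simp only [Pi.sub_apply] at h1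
    constructor <;> omega
  have hinj : Set.InjOn (fun z : V3 => z + x) ↑(box 3 k) := fun a _ b _ h => add_right_cancel h
  have hmaps : ∀ z ∈ box 3 k, z + x ∈ box 3 m := fun z hz =>
    Finset.mem_coe.1 (himg ⟨z, Finset.mem_coe.2 hz, by simp [zdShiftIso_apply]⟩)
  calc ∑ z ∈ box 3 k, (μ p).real (openConnIn ↑(box 3 k) 0 z)
      = ∑ z ∈ box 3 k, (μ p).real (openConnIn (⇑(zdShiftIso x) '' ↑(box 3 k)) x (z + x)) :=
        Finset.sum_congr rfl fun z _ => (real_openConnIn_shift_box p x z k).symm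
    _ ≤ ∑ z ∈ box 3 k, (μ p).real (openConnIn ↑(box 3 m) x (z + x)) :=
        Finset.sum_le_sum fun z _ => measureReal_mono (openConnIn_mono' himg x (z + x))
    _ = ∑ y ∈ (box 3 k).image (fun z => z + x), (μ p).real (openConnIn ↑(box 3 m) x y) :=
        (Finset.sum_image (f := fun y => (μ p).real (openConnIn ↑(box 3 m) x y)) hinj).symm
    _ ≤ ∑ y ∈ box 3 m, (μ p).real (openConnIn ↑(box 3 m) x y) := by
        refine Finset.sum_le_sum_of_subset_of_nonneg ?_ fun _ _ _ => measureReal_nonneg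
        intro y hy
        obtain ⟨z, hz, rfl⟩ := Finset.mem_image.1 hy
        exact hmaps z hz

/-- **The free pair sum at `p ≥ p_c` is at least `(n+1)⁴/12`.** [folklore] -/
theorem pairSum_ge (p : unitInterval) (hp : criticalProb (zdGraph 3) (0 : V3) ≤ p) (m : ℕ) :
    ((m : ℝ) + 1) ^ 4 / 12 ≤ pairSum p m := by
  set k : ℕ := m / 2 with hk
  set r : ℕ := m - m / 2 with hr
  have hrk : r + k ≤ m := by omega
  have hr2 : (m : ℝ) + 1 ≤ 2 * r + 1 := by
    have : m ≤ 2 * r := by omega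
    exact_mod_cast (show m + 1 ≤ 2 * r + 1 by omega)
  have hk2 : (m : ℝ) + 1 ≤ 2 * ((k : ℝ) + 1) := by
    have : m + 1 ≤ 2 * (k + 1) := by omega
    exact_mod_cast this
  -- restrict the outer sum to `B(r)` and bound each row
  have hrow : ∀ x ∈ box 3 r, ((k : ℝ) + 1) / 6 ≤ ∑ y ∈ box 3 m, (μ p).real (openConnIn ↑(box 3 m) x y) :=
    fun x hx => (sum_box_real_openConnIn_ge p hp k).trans (sum_box_real_openConnIn_shift_ge p hrk hx)
  have hsub : box 3 r ⊆ box 3 m := box_mono 3 (by omega)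
  have h1 : ((box 3 r).card : ℝ) * (((k : ℝ) + 1) / 6) ≤ pairSum p m := by
    calc ((box 3 r).card : ℝ) * (((k : ℝ) + 1) / 6) = ∑ _x ∈ box 3 r, ((k : ℝ) + 1) / 6 := by
          rw [Finset.sum_const, nsmul_eq_mul]
      _ ≤ ∑ x ∈ box 3 r, ∑ y ∈ box 3 m, (μ p).real (openConnIn ↑(box 3 m) x y) :=
          Finset.sum_le_sum hrow
      _ ≤ pairSum p m :=
          Finset.sum_le_sum_of_subset_of_nonneg hsub fun _ _ _ =>
            Finset.sum_nonneg fun _ _ => measureReal_nonneg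
  have hcr : ((m : ℝ) + 1) ^ 3 ≤ (box 3 r).card := by
    rw [card_box_real]
    have h0 : (0 : ℝ) ≤ (m : ℝ) + 1 := by positivity
    exact pow_le_pow_left₀ h0 hr2 3
  calc ((m : ℝ) + 1) ^ 4 / 12 = ((m : ℝ) + 1) ^ 3 * (((m : ℝ) + 1) / 2 / 6) := by ring
    _ ≤ ((box 3 r).card : ℝ) * (((k : ℝ) + 1) / 6) := by
        gcongr
        linarith
    _ ≤ pairSum p m := h1

/-- **`FA₂(p, n) ≥ 1 / (768 (n+1)²)` for `p ≥ p_c`**, in particular at `p_c`: the crux's quantity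
cannot decay faster than `n⁻²`. [folklore] -/
theorem FA2_ge (p : unitInterval) (hp : criticalProb (zdGraph 3) (0 : V3) ≤ p) (m : ℕ) :
    1 / (768 * ((m : ℝ) + 1) ^ 2) ≤ FA2 p m := by
  have hcard := card_box_pos m
  rw [FA2, le_div_iff₀ (by positivity), card_box_real]
  have hm : (0 : ℝ) ≤ m := Nat.cast_nonneg m
  have h6 : ((2 : ℝ) * m + 1) ^ 6 ≤ 64 * ((m : ℝ) + 1) ^ 6 := by
    have : (2 : ℝ) * m + 1 ≤ 2 * ((m : ℝ) + 1) := by linarith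
    calc ((2 : ℝ) * m + 1) ^ 6 ≤ (2 * ((m : ℝ) + 1)) ^ 6 := pow_le_pow_left₀ (by positivity) this 6
      _ = 64 * ((m : ℝ) + 1) ^ 6 := by ring
  calc 1 / (768 * ((m : ℝ) + 1) ^ 2) * (((2 : ℝ) * m + 1) ^ 3) ^ 2
      = ((2 : ℝ) * m + 1) ^ 6 / (768 * ((m : ℝ) + 1) ^ 2) := by ring
    _ ≤ 64 * ((m : ℝ) + 1) ^ 6 / (768 * ((m : ℝ) + 1) ^ 2) := by gcongr
    _ = ((m : ℝ) + 1) ^ 4 / 12 := by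
        field_simp
        ring
    _ ≤ pairSum p m := pairSum_ge p hp m

/-- The crux's quantity at `p_c`, bounded below: `FA₂(n) ≥ 1/(768 (n+1)²)`. [folklore] -/
theorem FA2_criticalProbI_ge (m : ℕ) : 1 / (768 * ((m : ℝ) + 1) ^ 2) ≤ FA2 (criticalProbI 3) m :=
  FA2_ge (criticalProbI 3) le_rfl m

/-- **The normalisation is load-bearing**: with `|B(n)|⁻¹` in place of `|B(n)|⁻²` (the free
susceptibility averaged over roots) the quotient is `≥ (n+1)/96 → ∞`. [folklore] -/
theorem freeSusceptibility_ge (p : unitInterval) (hp : criticalProb (zdGraph 3) (0 : V3) ≤ p) (m : ℕ) :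
    ((m : ℝ) + 1) / 96 ≤ pairSum p m / (box 3 m).card := by
  have hcard := card_box_pos m
  rw [le_div_iff₀ hcard, card_box_real]
  have h3 : ((2 : ℝ) * m + 1) ^ 3 ≤ 8 * ((m : ℝ) + 1) ^ 3 := by
    have hm : (0 : ℝ) ≤ m := Nat.cast_nonneg m
    have : (2 : ℝ) * m + 1 ≤ 2 * ((m : ℝ) + 1) := by linarith
    calc ((2 : ℝ) * m + 1) ^ 3 ≤ (2 * ((m : ℝ) + 1)) ^ 3 := pow_le_pow_left₀ (by positivity) this 3
      _ = 8 * ((m : ℝ) + 1) ^ 3 := by ring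
  calc ((m : ℝ) + 1) / 96 * ((2 : ℝ) * m + 1) ^ 3 ≤ ((m : ℝ) + 1) / 96 * (8 * ((m : ℝ) + 1) ^ 3) := by
        gcongr
    _ = ((m : ℝ) + 1) ^ 4 / 12 := by ring
    _ ≤ pairSum p m := pairSum_ge p hp m

/-- The root-averaged free susceptibility at `p_c` diverges (at least linearly). [folklore] -/
theorem tendsto_freeSusceptibility_atTop :
    Tendsto (fun m : ℕ => pairSum (criticalProbI 3) m / (box 3 m).card) atTop atTop := by
  refine tendsto_atTop_mono (fun m => freeSusceptibility_ge (criticalProbI 3) le_rfl m) ?_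
  refine Tendsto.atTop_div_const (by norm_num) ?_
  exact tendsto_natCast_atTop_atTop.atTop_add tendsto_const_nhds

/-- NATURAL STRENGTHENING REFUTED: the `|B(n)|⁻¹`-normalised variant of the crux is false.
[folklore] -/
theorem not_tendsto_freeSusceptibility_zero :
    ¬ Tendsto (fun m : ℕ => pairSum (criticalProbI 3) m / (box 3 m).card) atTop (𝓝 0) :=
  fun h => not_tendsto_nhds_of_tendsto_atTop tendsto_freeSusceptibility_atTop 0 h

/-- **The sibling crux `FreeBoxPowerSaving` (stmt-4447) can only hold with exponent `a ≤ 2`.**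
[folklore] -/
theorem powerSaving_exponent_le_two {a C : ℝ}
    (h : ∀ n : ℕ, 1 ≤ n → FA2 (criticalProbI 3) n ≤ C * (n : ℝ) ^ (-a)) : a ≤ 2 := by
  by_contra ha
  push Not at ha
  -- `n ^ (a - 2) → ∞`; pick `n ≥ 1` with `n ^ (a-2) > 3072 C + 1`
  have hlim : Tendsto (fun n : ℕ => (n : ℝ) ^ (a - 2)) atTop atTop :=
    (tendsto_rpow_atTop (by linarith)).comp tendsto_natCast_atTop_atTop
  obtain ⟨n, hn⟩ := ((hlim.eventually_gt_atTop (3072 * C + 1)).and (eventually_ge_atTop 1)).exists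
  obtain ⟨hbig, hn1⟩ := hn
  have hnpos : (0 : ℝ) < n := by exact_mod_cast hn1
  have hFA := (FA2_criticalProbI_ge n).trans (h n hn1)
  -- `C n^{-a} ≥ 1/(768 (n+1)²) ≥ 1/(3072 n²)`, so `n^{a-2} ≤ 3072 C`
  have hn1' : (1 : ℝ) ≤ n := by exact_mod_cast hn1
  have hsq : ((n : ℝ) + 1) ^ 2 ≤ 4 * (n : ℝ) ^ 2 := by nlinarith
  have hlow : 1 / (3072 * (n : ℝ) ^ 2) ≤ C * (n : ℝ) ^ (-a) := by
    refine le_trans ?_ hFA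
    rw [div_le_div_iff₀ (by positivity) (by positivity)]
    linarith
  have hsplit : (n : ℝ) ^ (-a) = ((n : ℝ) ^ (a - 2) * (n : ℝ) ^ 2)⁻¹ := by
    rw [← Real.rpow_natCast, ← Real.rpow_add hnpos, Real.rpow_neg hnpos.le]
    push_cast; ring_nf
  rw [hsplit] at hlow
  have hpow : (0 : ℝ) < (n : ℝ) ^ (a - 2) := Real.rpow_pos_of_pos hnpos _
  have hC : (n : ℝ) ^ (a - 2) ≤ 3072 * C := by
    have h' := hlow
    rw [div_le_iff₀ (by positivity)] at h'
    -- h' : 1 ≤ C * (n^(a-2) * n^2)⁻¹ * (3072 * n^2)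
    have : C * ((n : ℝ) ^ (a - 2) * (n : ℝ) ^ 2)⁻¹ * (3072 * (n : ℝ) ^ 2) = 3072 * C / (n : ℝ) ^ (a - 2) := by
      field_simp
    rw [this, le_div_iff₀ hpow] at h'
    linarith
  linarith


/-! ## §6 Monotonicity and left-continuity in `p`: the crux is a UNIFORM SUBCRITICAL statement

`p ↦ FA₂(p, n)` is nondecreasing (increasing events, monotone coupling) and continuous (a polynomial),
so `FA₂(p_c, n) = sup_{p < p_c} FA₂(p, n)` and the crux says exactly: the subcritical free-box pair
averages tend to `0` UNIFORMLY in `p < p_c`. For each fixed `p < p_c` they do tend to `0`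
(`freeBoxSparseAt_of_lt_criticalProb`); the whole content is the uniformity as `p ↑ p_c`. -/

/-- `P_p(x ↔ y in B(n))` is nondecreasing in `p`. [folklore] -/
theorem real_openConnIn_box_mono {p q : unitInterval} (hpq : p ≤ q) (n : ℕ) (x y : V3) :
    (μ p).real (openConnIn ↑(box 3 n) x y) ≤ (μ q).real (openConnIn ↑(box 3 n) x y) :=
  DCT16.real_mono_of_isUpperSet (zdGraph 3) (isUpperSet_openConnIn _ x y)
    (DCT16.measurableSet_openConnIn (box 3 n) x y) hpq

/-- `FA₂(p, n)` is nondecreasing in `p`. [folklore] -/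
theorem FA2_mono {p q : unitInterval} (hpq : p ≤ q) (n : ℕ) : FA2 p n ≤ FA2 q n := by
  unfold FA2 pairSum
  exact div_le_div_of_nonneg_right
    (Finset.sum_le_sum fun x _ => Finset.sum_le_sum fun y _ => real_openConnIn_box_mono hpq n x y)
    (sq_nonneg _)

/-- `p ↦ FA₂(p, n)` is continuous (each term is a polynomial in `p`). [folklore] -/
theorem continuous_FA2 (n : ℕ) : Continuous fun p : unitInterval => FA2 p n := by
  unfold FA2 pairSum
  refine Continuous.div_const (continuous_finsetSum _ fun x _ => continuous_finsetSum _ fun y _ => ?_) _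
  exact continuous_bondPercolation_real_of_determinedBy (zdGraph 3)
    (DCT16.determinedBy_openConnIn (↑(box 3 n) : Set V3) x y (K := ↑(box 3 n).sym2)
      (by rw [Finset.coe_sym2]))

/-- `FreeBoxSparseAt` is downward closed in `p`. [folklore] -/
theorem freeBoxSparseAt_anti {p q : unitInterval} (hpq : p ≤ q) (h : FreeBoxSparseAt q) :
    FreeBoxSparseAt p :=
  squeeze_zero (FA2_nonneg p) (fun n => FA2_mono hpq n) h

/-- **Left-continuity transfer**: a bound `FA₂(p, n) ≤ c` valid for all `p < p_c` holds at `p_c`.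
[folklore] -/
theorem FA2_criticalProbI_le_of_forall_lt (n : ℕ) {c : ℝ}
    (h : ∀ p : unitInterval, (p : ℝ) < criticalProb (zdGraph 3) (0 : V3) → FA2 p n ≤ c) :
    FA2 (criticalProbI 3) n ≤ c := by
  have hpc : 0 < criticalProb (zdGraph 3) (0 : V3) := criticalProb_zd_pos 3 (by norm_num)
  have hclosed : IsClosed {p : unitInterval | FA2 p n ≤ c} :=
    isClosed_le (continuous_FA2 n) continuous_const
  have hsub : Set.Iio (criticalProbI 3) ⊆ {p : unitInterval | FA2 p n ≤ c} := fun p hp => h p hp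
  have hne : (Set.Iio (criticalProbI 3)).Nonempty :=
    ⟨0, show (0 : unitInterval) < criticalProbI 3 by exact_mod_cast hpc⟩
  have hmem : criticalProbI 3 ∈ closure (Set.Iio (criticalProbI 3)) := by
    rw [closure_Iio' hne]; exact Set.self_mem_Iic
  exact hclosed.closure_subset_iff.2 hsub hmem

/-- `FA₂(p_c, n)` is the supremum of the subcritical values. [folklore] -/
theorem FA2_criticalProbI_eq_sSup (n : ℕ) :
    FA2 (criticalProbI 3) n =
      sSup ((fun p : unitInterval => FA2 p n) '' {p | (p : ℝ) < criticalProb (zdGraph 3) (0 : V3)}) := by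
  have hpc : 0 < criticalProb (zdGraph 3) (0 : V3) := criticalProb_zd_pos 3 (by norm_num)
  have hne : ((fun p : unitInterval => FA2 p n) '' {p | (p : ℝ) < criticalProb (zdGraph 3) (0 : V3)}).Nonempty :=
    ⟨_, ⟨0, by simpa using hpc, rfl⟩⟩
  have hbdd : ∀ b ∈ (fun p : unitInterval => FA2 p n) '' {p | (p : ℝ) < criticalProb (zdGraph 3) (0 : V3)},
      b ≤ FA2 (criticalProbI 3) n := by
    rintro b ⟨p, hp, rfl⟩
    exact FA2_mono (Subtype.coe_le_coe.1 (by rw [coe_criticalProbI]; exact le_of_lt hp)) n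
  refine le_antisymm ?_ (csSup_le hne hbdd)
  exact FA2_criticalProbI_le_of_forall_lt n fun p hp => le_csSup ⟨_, hbdd⟩ ⟨p, hp, rfl⟩

/-- **The crux as a uniform subcritical statement**: `FreeBoxSparse` iff for every `ε > 0` there is
`N` with `FA₂(p, n) < ε` for all `n ≥ N` and ALL `p < p_c`. [folklore] -/
theorem freeBoxSparse_iff_uniform_subcritical :
    Theses.PercNonProliferation.FreeBoxSparse ↔
      ∀ ε : ℝ, 0 < ε → ∃ N : ℕ, ∀ n, N ≤ n → ∀ p : unitInterval,
        (p : ℝ) < criticalProb (zdGraph 3) (0 : V3) → FA2 p n < ε := by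
  rw [freeBoxSparse_iff, FreeBoxSparseAt, Metric.tendsto_atTop]
  constructor
  · intro h ε hε
    obtain ⟨N, hN⟩ := h ε hε
    refine ⟨N, fun n hn p hp => ?_⟩
    have h1 := hN n hn
    rw [Real.dist_eq, sub_zero, abs_of_nonneg (FA2_nonneg _ n)] at h1
    have hle : p ≤ criticalProbI 3 :=
      Subtype.coe_le_coe.1 (by rw [coe_criticalProbI]; exact le_of_lt hp)
    exact (FA2_mono hle n).trans_lt h1
  · intro h ε hε
    obtain ⟨N, hN⟩ := h (ε / 2) (by linarith)
    refine ⟨N, fun n hn => ?_⟩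
    rw [Real.dist_eq, sub_zero, abs_of_nonneg (FA2_nonneg _ n)]
    have : FA2 (criticalProbI 3) n ≤ ε / 2 :=
      FA2_criticalProbI_le_of_forall_lt n fun p hp => (hN n hn p hp).le
    linarith

/-! ## §7 Equivalent centred forms: the sibling items stmt-4644 / stmt-5836 are the SAME statement

`F(r) := |B(r)|⁻¹ Σ_{x∈B(r)} P(0 ↔ x in B(r))` (route PercHyperscalingGluing, `FreeBoxShattering`,
stmt-4644; route PercHollowCells, `FreeBoxShattering`, stmt-5836, with `(2r+1)³` for `|B(r)|`).
Re-rooting within a factor 64: `F(r) ≤ 64 FA₂(2r)` and `FA₂(n) ≤ 8 F(2n)`; so refuting (or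
proving) any one of the three items settles all of them. -/

/-- The centred free susceptibility `Σ_{x∈B(r)} P_p(0 ↔ x in B(r)) = E_p|C_{B(r)}(0)|`. [folklore] -/
def centredSum (p : unitInterval) (r : ℕ) : ℝ :=
  ∑ x ∈ box 3 r, (μ p).real (openConnIn ↑(box 3 r) 0 x)

/-- `centredSum ≥ 0`. [folklore] -/
theorem centredSum_nonneg (p : unitInterval) (r : ℕ) : 0 ≤ centredSum p r :=
  Finset.sum_nonneg fun _ _ => measureReal_nonneg

/-- `|B(r)| · E|C_{B(r)}(0)| ≤ Σ_{x,y∈B(2r)} P(x ↔ y in B(2r))` (translate the root over `B(r)`).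
[folklore] -/
theorem card_mul_centredSum_le_pairSum (p : unitInterval) (r : ℕ) :
    ((box 3 r).card : ℝ) * centredSum p r ≤ pairSum p (2 * r) := by
  calc ((box 3 r).card : ℝ) * centredSum p r = ∑ _x ∈ box 3 r, centredSum p r := by
        rw [Finset.sum_const, nsmul_eq_mul]
    _ ≤ ∑ x ∈ box 3 r, ∑ y ∈ box 3 (2 * r), (μ p).real (openConnIn ↑(box 3 (2 * r)) x y) :=
        Finset.sum_le_sum fun x hx => sum_box_real_openConnIn_shift_ge p (by omega) hx
    _ ≤ pairSum p (2 * r) :=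
        Finset.sum_le_sum_of_subset_of_nonneg (box_mono 3 (by omega)) fun _ _ _ =>
          Finset.sum_nonneg fun _ _ => measureReal_nonneg

/-- `Σ_{x,y∈B(n)} P(x ↔ y in B(n)) ≤ |B(n)| · E|C_{B(2n)}(0)|` (enlarge `B(n) ⊆ x + B(2n)` and
re-root at `x`). [folklore] -/
theorem pairSum_le_card_mul_centredSum (p : unitInterval) (n : ℕ) :
    pairSum p n ≤ ((box 3 n).card : ℝ) * centredSum p (2 * n) := by
  have hrow : ∀ x ∈ box 3 n,
      ∑ y ∈ box 3 n, (μ p).real (openConnIn ↑(box 3 n) x y) ≤ centredSum p (2 * n) := by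
    intro x hx
    have himg : (↑(box 3 n) : Set V3) ⊆ ⇑(zdShiftIso x) '' (↑(box 3 (2 * n)) : Set V3) := by
      intro w hw
      rw [mem_image_zdShiftIso_box_iff]
      rw [Finset.mem_coe, mem_box] at hw
      rw [mem_box] at hx ⊢
      intro i
      have h1 := hw i; have h2 := hx i
      simp only [Pi.sub_apply]
      constructor <;> push_cast <;> omega
    have hinj : Set.InjOn (fun y : V3 => y - x) ↑(box 3 n) := fun a _ b _ h => sub_left_injective h
    have hmaps : ∀ y ∈ box 3 n, y - x ∈ box 3 (2 * n) := fun y hy =>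
      mem_image_zdShiftIso_box_iff.1 (himg (Finset.mem_coe.2 hy))
    calc ∑ y ∈ box 3 n, (μ p).real (openConnIn ↑(box 3 n) x y)
        ≤ ∑ y ∈ box 3 n, (μ p).real (openConnIn (⇑(zdShiftIso x) '' ↑(box 3 (2 * n))) x (y - x + x)) := by
          refine Finset.sum_le_sum fun y _ => measureReal_mono ?_
          rw [sub_add_cancel]
          exact openConnIn_mono' himg x y
      _ = ∑ y ∈ box 3 n, (μ p).real (openConnIn ↑(box 3 (2 * n)) 0 (y - x)) :=
          Finset.sum_congr rfl fun y _ => real_openConnIn_shift_box p x (y - x) (2 * n)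
      _ = ∑ z ∈ (box 3 n).image (fun y => y - x), (μ p).real (openConnIn ↑(box 3 (2 * n)) 0 z) :=
          (Finset.sum_image (f := fun z => (μ p).real (openConnIn ↑(box 3 (2 * n)) 0 z)) hinj).symm
      _ ≤ centredSum p (2 * n) := by
          refine Finset.sum_le_sum_of_subset_of_nonneg ?_ fun _ _ _ => measureReal_nonneg
          intro z hz
          obtain ⟨y, hy, rfl⟩ := Finset.mem_image.1 hz
          exact hmaps y hy
  calc pairSum p n ≤ ∑ _x ∈ box 3 n, centredSum p (2 * n) := Finset.sum_le_sum hrow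
    _ = ((box 3 n).card : ℝ) * centredSum p (2 * n) := by rw [Finset.sum_const, nsmul_eq_mul]

/-- `|B(2n)| ≤ 8 |B(n)|`. [folklore] -/
theorem card_box_two_mul_le (n : ℕ) : ((box 3 (2 * n)).card : ℝ) ≤ 8 * (box 3 n).card := by
  rw [card_box_real, card_box_real]; push_cast
  nlinarith [sq_nonneg (n : ℝ), (Nat.cast_nonneg n : (0 : ℝ) ≤ n)]

/-- `F(r) ≤ 64 FA₂(2r)`. [folklore] -/
theorem centredAvg_le (p : unitInterval) (r : ℕ) :
    centredSum p r / (box 3 r).card ≤ 64 * FA2 p (2 * r) := by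
  have hc := card_box_pos r
  have hc2 := card_box_pos (2 * r)
  rw [FA2, div_le_iff₀ hc]
  have h1 := card_mul_centredSum_le_pairSum p r
  have h8 := card_box_two_mul_le r
  calc centredSum p r ≤ pairSum p (2 * r) / (box 3 r).card := by
        rw [le_div_iff₀ hc]; linarith
    _ = pairSum p (2 * r) / ((box 3 (2 * r)).card : ℝ) ^ 2 * (((box 3 (2 * r)).card : ℝ) ^ 2 / (box 3 r).card) := by
        field_simp
    _ ≤ pairSum p (2 * r) / ((box 3 (2 * r)).card : ℝ) ^ 2 * ((8 * (box 3 r).card) ^ 2 / (box 3 r).card) := by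
        gcongr
        exact div_nonneg (pairSum_nonneg p _) (sq_nonneg _)
    _ = 64 * (pairSum p (2 * r) / ((box 3 (2 * r)).card : ℝ) ^ 2) * (box 3 r).card := by
        field_simp
        ring

/-- `FA₂(n) ≤ 8 F(2n)`. [folklore] -/
theorem FA2_le_centredAvg (p : unitInterval) (n : ℕ) :
    FA2 p n ≤ 8 * (centredSum p (2 * n) / (box 3 (2 * n)).card) := by
  have hc := card_box_pos n
  have hc2 := card_box_pos (2 * n)
  rw [FA2, div_le_iff₀ (by positivity)]
  have h1 := pairSum_le_card_mul_centredSum p n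
  have h8 := card_box_two_mul_le n
  calc pairSum p n ≤ ((box 3 n).card : ℝ) * centredSum p (2 * n) := h1
    _ = (centredSum p (2 * n) / (box 3 (2 * n)).card) * ((box 3 (2 * n)).card * (box 3 n).card) := by
        field_simp
    _ ≤ (centredSum p (2 * n) / (box 3 (2 * n)).card) * ((8 * (box 3 n).card) * (box 3 n).card) := by
        gcongr
        exact div_nonneg (centredSum_nonneg p _) hc2.le
    _ = 8 * (centredSum p (2 * n) / (box 3 (2 * n)).card) * ((box 3 n).card : ℝ) ^ 2 := by ring

/-- `n ↦ 2n` tends to infinity. [folklore] -/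
theorem tendsto_two_mul_atTop : Tendsto (fun n : ℕ => 2 * n) atTop atTop :=
  tendsto_atTop_mono (fun n => show id n ≤ 2 * n by simp only [id]; omega) tendsto_id

/-- **Centred form ⇔ pair form** at every `p`. [folklore] -/
theorem tendsto_centredAvg_iff_freeBoxSparseAt (p : unitInterval) :
    Tendsto (fun r : ℕ => centredSum p r / (box 3 r).card) atTop (𝓝 0) ↔ FreeBoxSparseAt p := by
  constructor
  · intro h
    have h2 : Tendsto (fun n : ℕ => 8 * (centredSum p (2 * n) / (box 3 (2 * n)).card)) atTop (𝓝 0) := by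
      simpa using (h.comp tendsto_two_mul_atTop).const_mul 8
    exact squeeze_zero (FA2_nonneg p) (FA2_le_centredAvg p) h2
  · intro h
    have h2 : Tendsto (fun r : ℕ => 64 * FA2 p (2 * r)) atTop (𝓝 0) := by
      simpa using (h.comp tendsto_two_mul_atTop).const_mul 64
    exact squeeze_zero (fun r => div_nonneg (centredSum_nonneg p r) (card_box_pos r).le)
      (centredAvg_le p) h2

/-- **`FreeBoxSparse` (stmt-4445) ⇔ `PercHyperscalingGluing.FreeBoxShattering` (stmt-4644).**
[folklore] -/
theorem freeBoxSparse_iff_hyperscalingGluing_freeBoxShattering :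
    Theses.PercNonProliferation.FreeBoxSparse ↔ Theses.PercHyperscalingGluing.FreeBoxShattering := by
  rw [freeBoxSparse_iff, ← tendsto_centredAvg_iff_freeBoxSparseAt]
  have : (fun r : ℕ => centredSum (criticalProbI 3) r / (box 3 r).card) =
      fun r : ℕ => ((box 3 r).card : ℝ)⁻¹ * ∑ x ∈ box 3 r,
        (bondPercolation (zdGraph 3) (criticalProbI 3)).real (openConnIn ↑(box 3 r) 0 x) := by
    funext r; rw [div_eq_inv_mul]; rfl
  rw [this]; rfl

/-- **`FreeBoxSparse` (stmt-4445) ⇔ `PercHollowCells.FreeBoxShattering` (stmt-5836).** [folklore] -/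
theorem freeBoxSparse_iff_hollowCells_freeBoxShattering :
    Theses.PercNonProliferation.FreeBoxSparse ↔ Theses.PercHollowCells.FreeBoxShattering := by
  rw [freeBoxSparse_iff, ← tendsto_centredAvg_iff_freeBoxSparseAt]
  have : (fun r : ℕ => centredSum (criticalProbI 3) r / (box 3 r).card) =
      fun L : ℕ => (∑ x ∈ box 3 L,
        (bondPercolation (zdGraph 3) (criticalProbI 3)).real (openConnIn ↑(box 3 L) 0 x)) /
          ((2 * (L : ℝ) + 1) ^ 3) := by
    funext r; rw [card_box_real]; rfl
  rw [this]; rfl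


/-! ## §8 The upper sandwich: `FA₂(p, n) ≤ θ(p)² + o(1)` at EVERY `p`

Two disjoint boxes (tree: `tau_le_oneArmProb_sq_of_coord`): `τ_p(0,v) ≤ π_p(n)²` for `v ∉ B(2n)`,
and `π_p(n) ↓ θ(p)`; with `θ(p)² ≤ τ_p` (uniqueness + FKG) this gives `τ_p(0,v) → θ(p)²`, hence the
bulk pair average tends to `θ(p)²` and the free one is asymptotically AT MOST `θ(p)²`. Together with
the route's SpanningPiecesCount (`FA₂ ≳ θ²/N_n` in a jump world) the crux's quantity is sandwiched:
`θ(p_c)²/N_n ≲ FA₂(p_c, n) ≲ θ(p_c)²`. So `¬ crux` means PRECISELY: a jump AND a non-vanishing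
fraction (at most 1) of the `θ²|B(n)|²` percolating pairs glued inside the box. -/

/-- The one-arm probabilities get within `ε` of `θ(p)` (they decrease to it). [folklore] -/
theorem exists_oneArmProb_lt (p : unitInterval) {ε : ℝ} (hε : 0 < ε) :
    ∃ n : ℕ, oneArmProb 3 p n < theta (zdGraph 3) 0 p + ε := by
  by_contra h
  push Not at h
  have := DCT16.le_theta_of_forall_le_real_siteToBoundary (d := 3) p h
  linarith

/-- Two disjoint boxes: `τ_p(0, v) ≤ π_p(n)²` for `v ∉ B(2n)`. [folklore] -/
theorem tau_le_oneArmProb_sq {n : ℕ} {v : V3} (hv : v ∉ box 3 (2 * n)) (p : unitInterval) :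
    tau 3 p 0 v ≤ oneArmProb 3 p n ^ 2 := by
  rw [mem_box] at hv
  push Not at hv
  obtain ⟨i, hi⟩ := hv
  refine tau_le_oneArmProb_sq_of_coord n p i (le_abs'.2 ?_)
  by_cases h : -((2 * n : ℕ) : ℤ) ≤ v i
  · have := hi h; push_cast at this ⊢; omega
  · push_cast at h ⊢; omega

/-- **`τ_p(0, v) → θ(p)²` as `v → ∞`** (every `p`; lower bound `θ² ≤ τ` by uniqueness + FKG,
upper bound by two disjoint boxes). [folklore] -/
theorem tendsto_tau_sub_theta_sq (p : unitInterval) :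
    Tendsto (fun v : V3 => tau 3 p 0 v - theta (zdGraph 3) 0 p ^ 2) cofinite (𝓝 0) := by
  rw [Metric.tendsto_nhds]
  intro ε hε
  set θ := theta (zdGraph 3) 0 p with hθ
  have hθ0 : 0 ≤ θ := measureReal_nonneg
  have hθ1 : θ ≤ 1 := measureReal_le_one
  have hδ : 0 < min (ε / 4) 1 := lt_min (by linarith) one_pos
  obtain ⟨n, hn⟩ := exists_oneArmProb_lt p hδ
  have hπ0 : 0 ≤ oneArmProb 3 p n := (oneArmProb_mem_Icc 3 p n).1
  refine Filter.eventually_cofinite.2 ((box 3 (2 * n)).finite_toSet.subset fun v hv => ?_)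
  by_contra hvb
  apply hv
  have hlow : θ ^ 2 ≤ tau 3 p 0 v := Grimmett1999_theta_sq_le_openConn_holds 3 p 0 v
  have hup : tau 3 p 0 v ≤ oneArmProb 3 p n ^ 2 := tau_le_oneArmProb_sq (fun h => hvb h) p
  rw [Real.dist_eq, sub_zero, abs_of_nonneg (by linarith)]
  have h1 : oneArmProb 3 p n < θ + min (ε / 4) 1 := hn
  have hm1 : min (ε / 4) 1 ≤ ε / 4 := min_le_left _ _
  have hm2 : min (ε / 4) 1 ≤ 1 := min_le_right _ _
  nlinarith

/-- **The bulk pair average tends to `θ(p)²`** (every `p`). [folklore] -/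
theorem tendsto_bulkPairAverage (p : unitInterval) :
    Tendsto (fun n : ℕ => (∑ x ∈ box 3 n, ∑ y ∈ box 3 n, tau 3 p x y) / ((box 3 n).card : ℝ) ^ 2)
      atTop (𝓝 (theta (zdGraph 3) 0 p ^ 2)) := by
  set θ := theta (zdGraph 3) 0 p with hθ
  have h := tendsto_pairAverage_of_tendsto_cofinite (tendsto_tau_sub_theta_sq p)
    (g := fun _ x y => tau 3 p x y - θ ^ 2)
    (fun _ x y => sub_nonneg.2 (Grimmett1999_theta_sq_le_openConn_holds 3 p x y))
    (fun _ x y => by linarith [tau_le_one p x y, sq_nonneg θ])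
    (fun _ x y => by rw [tau_eq_tau_zero_sub p x y])
  have heq : ∀ n : ℕ, (∑ x ∈ box 3 n, ∑ y ∈ box 3 n, (tau 3 p x y - θ ^ 2)) / ((box 3 n).card : ℝ) ^ 2
      = (∑ x ∈ box 3 n, ∑ y ∈ box 3 n, tau 3 p x y) / ((box 3 n).card : ℝ) ^ 2 - θ ^ 2 := by
    intro n
    have hc := card_box_pos n
    simp only [Finset.sum_sub_distrib, Finset.sum_const, nsmul_eq_mul]
    field_simp
  have h' : Tendsto (fun n : ℕ => (∑ x ∈ box 3 n, ∑ y ∈ box 3 n, tau 3 p x y) /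
      ((box 3 n).card : ℝ) ^ 2 - θ ^ 2) atTop (𝓝 0) := h.congr heq
  have h'' := h'.add_const (θ ^ 2)
  simpa using h''

/-- Free ≤ bulk: `FA₂(p, n)` is at most the bulk pair average. [folklore] -/
theorem FA2_le_bulkPairAverage (p : unitInterval) (n : ℕ) :
    FA2 p n ≤ (∑ x ∈ box 3 n, ∑ y ∈ box 3 n, tau 3 p x y) / ((box 3 n).card : ℝ) ^ 2 :=
  div_le_div_of_nonneg_right
    (Finset.sum_le_sum fun x _ => Finset.sum_le_sum fun y _ => by
      rw [tau_def]; exact measureReal_mono (openConnIn_subset_openConn _ x y))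
    (sq_nonneg _)

/-- **The upper sandwich**: for every `p` and `ε > 0`, eventually `FA₂(p, n) ≤ θ(p)² + ε`. In a
jump world the crux's quantity is asymptotically at most `θ(p_c)²`; the crux asks whether it is
asymptotically `0`. [folklore] -/
theorem eventually_FA2_le (p : unitInterval) {ε : ℝ} (hε : 0 < ε) :
    ∀ᶠ n : ℕ in atTop, FA2 p n ≤ theta (zdGraph 3) 0 p ^ 2 + ε := by
  have h := (tendsto_bulkPairAverage p).eventually
    (Iio_mem_nhds (lt_add_of_pos_right (theta (zdGraph 3) 0 p ^ 2) hε))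
  filter_upwards [h] with n hn using (FA2_le_bulkPairAverage p n).trans hn.le

/-- Second proof of §1 from the sandwich: `θ(p) = 0 ⇒ FA₂(p, ·) → 0`. [folklore] -/
theorem freeBoxSparseAt_of_theta_eq_zero' (p : unitInterval) (hθ : theta (zdGraph 3) 0 p = 0) :
    FreeBoxSparseAt p := by
  have h := tendsto_bulkPairAverage p
  rw [hθ, zero_pow two_ne_zero] at h
  exact squeeze_zero (FA2_nonneg p) (FA2_le_bulkPairAverage p) h


/-! ## §9 The form the Assembly consumes: pairs of `B(n)` joined inside `B(2n)`

The route's density count uses `S_n := #{(x,y) ∈ B(n)² : x ↔ y inside B(2n)}` and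
`E S_n ≤ Σ_{x,y∈B(2n)} P(x ↔ y in B(2n)) ≤ 64 FA₂(2n) |B(n)|²`; conversely `FA₂(n) |B(n)|² ≤ E S_n`.
So "`E S_n = o(|B(n)|²)`" is again the crux — recorded to pre-empt a fourth name for it. -/

/-- `E S_n = Σ_{x,y∈B(n)} P_p(x ↔ y in B(2n))`. [folklore] -/
def annPairSum (p : unitInterval) (n : ℕ) : ℝ :=
  ∑ x ∈ box 3 n, ∑ y ∈ box 3 n, (μ p).real (openConnIn ↑(box 3 (2 * n)) x y)

/-- `pairSum(n) ≤ E S_n` (connections inside `B(n)` are inside `B(2n)`). [folklore] -/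
theorem pairSum_le_annPairSum (p : unitInterval) (n : ℕ) : pairSum p n ≤ annPairSum p n :=
  Finset.sum_le_sum fun x _ => Finset.sum_le_sum fun y _ =>
    measureReal_mono (openConnIn_mono' (Finset.coe_subset.2 (box_mono 3 (by omega))) x y)

/-- `E S_n ≤ pairSum(2n)` (enlarge the range of the pair). [folklore] -/
theorem annPairSum_le_pairSum (p : unitInterval) (n : ℕ) : annPairSum p n ≤ pairSum p (2 * n) := by
  unfold annPairSum pairSum
  calc ∑ x ∈ box 3 n, ∑ y ∈ box 3 n, (μ p).real (openConnIn ↑(box 3 (2 * n)) x y)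
      ≤ ∑ x ∈ box 3 n, ∑ y ∈ box 3 (2 * n), (μ p).real (openConnIn ↑(box 3 (2 * n)) x y) :=
        Finset.sum_le_sum fun x _ =>
          Finset.sum_le_sum_of_subset_of_nonneg (box_mono 3 (by omega)) fun _ _ _ => measureReal_nonneg
    _ ≤ ∑ x ∈ box 3 (2 * n), ∑ y ∈ box 3 (2 * n), (μ p).real (openConnIn ↑(box 3 (2 * n)) x y) :=
        Finset.sum_le_sum_of_subset_of_nonneg (box_mono 3 (by omega)) fun _ _ _ =>
          Finset.sum_nonneg fun _ _ => measureReal_nonneg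

/-- **`E S_n / |B(n)|² → 0 ⇔ FA₂ → 0`** (every `p`). [folklore] -/
theorem tendsto_annPairAverage_iff (p : unitInterval) :
    Tendsto (fun n : ℕ => annPairSum p n / ((box 3 n).card : ℝ) ^ 2) atTop (𝓝 0) ↔
      FreeBoxSparseAt p := by
  constructor
  · intro h
    exact squeeze_zero (FA2_nonneg p)
      (fun n => div_le_div_of_nonneg_right (pairSum_le_annPairSum p n) (sq_nonneg _)) h
  · intro h
    have h2 : Tendsto (fun n : ℕ => 64 * FA2 p (2 * n)) atTop (𝓝 0) := by
      simpa using (h.comp tendsto_two_mul_atTop).const_mul 64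
    refine squeeze_zero (fun n => div_nonneg ?_ (sq_nonneg _)) (fun n => ?_) h2
    · exact Finset.sum_nonneg fun _ _ => Finset.sum_nonneg fun _ _ => measureReal_nonneg
    · have hc := card_box_pos n
      have hc2 := card_box_pos (2 * n)
      have h8 := card_box_two_mul_le n
      rw [FA2, div_le_iff₀ (by positivity)]
      calc annPairSum p n ≤ pairSum p (2 * n) := annPairSum_le_pairSum p n
        _ = pairSum p (2 * n) / ((box 3 (2 * n)).card : ℝ) ^ 2 * ((box 3 (2 * n)).card : ℝ) ^ 2 := by
            field_simp
        _ ≤ pairSum p (2 * n) / ((box 3 (2 * n)).card : ℝ) ^ 2 * (8 * (box 3 n).card) ^ 2 := by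
            gcongr
            exact div_nonneg (pairSum_nonneg p _) (sq_nonneg _)
        _ = 64 * (pairSum p (2 * n) / ((box 3 (2 * n)).card : ℝ) ^ 2) * ((box 3 n).card : ℝ) ^ 2 := by
            ring

/-! ## §10 NUMERICS (MC j007901, kit/freebox_fa2.py, p = 0.2488126, seed 20260816; scipy connected_components on
the free box; columns: n, L=4n+1, samples, FA₂(B(2n)), FA₂in(n) = E S_n/|B(n)|² (pairs of B(n) joined
inside B(2n)), FA₂(B(n)) (side 2n+1), F(2n) = E|C_{B(2n)}(0)|/|B(2n)|, |K_max|/|B(2n)|, E N_n, P(N_n ≤ 3),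
P(B(n) ↔ ∂B(2n)); N_n = number of clusters of B(2n) meeting B(n) and ∂B(2n) (crux NonProliferation).

  n    L  samp   FA2(2n)     FA2in(n)    FA2(n)      F(2n)       Mfrac(2n)   E N_n  P(N<=3) cross
  2    9    2000   3.595e-02   1.128e-01   7.542e-02   6.354e-02   1.348e-01   9.00   0.011   1.000
  4    17   1000   1.684e-02   6.266e-02   3.501e-02   3.201e-02   9.243e-02   11.43  0.000   1.000
  8    33   300    8.575e-03   3.434e-02   1.818e-02   1.871e-02   6.608e-02   13.01  0.000   1.000
  16   65   100    4.865e-03   1.955e-02   8.891e-03   9.292e-03   5.114e-02   13.61  0.010   1.000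
  24   97   40     2.776e-03   1.136e-02   4.900e-03   3.366e-03   3.690e-02   13.43  0.000   1.000
  32   129  20     2.141e-03   1.035e-02   4.100e-03   2.751e-03   3.480e-02   14.40  0.000   1.000

  N_n histograms (counts for N_n = 0,1,2,...):
  n=2: [0, 1, 5, 15, 36, 83, 149, 268, 301, 322, 283, 244, 136, 75, 50, 20, 11, 1]
  n=4: [0, 0, 0, 0, 1, 6, 23, 36, 82, 108, 132, 123, 138, 132, 82, 71, 33, 17, 8, 4, 2, 2]
  n=8: [0, 0, 0, 0, 0, 0, 1, 7, 12, 19, 30, 30, 30, 37, 37, 34, 23, 15, 18, 4, 3]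
  n=16: [0, 0, 0, 1, 0, 0, 0, 2, 2, 3, 5, 10, 11, 15, 14, 12, 7, 9, 4, 1, 2, 2]
  n=24: [0, 0, 0, 0, 0, 0, 0, 1, 2, 3, 3, 1, 6, 3, 6, 5, 2, 5, 1, 0, 1, 1]
  n=32: [0, 0, 0, 0, 0, 0, 0, 0, 0, 1, 2, 1, 0, 5, 3, 2, 0, 3, 0, 1, 1, 1]

  log-log slopes vs L: FA2_big_box_2n -1.042, FA2_box_n -1.141, FA2in -0.918, F_centred_2n -1.186, Mfrac_2n -0.509
  (prediction: FA₂ ∝ L^{-(1+η)} = L^{-0.954}; |K_max|/|B| ∝ L^{d_f-3} = L^{-0.477}; DCT floor FA₂ ≥ 1/(768(n+1)²);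
   NonProliferation predicts E N_n = O(1) with P(N_n ≤ 3) bounded below; d > 6 would give N_n ≈ n^{d-6}.)

  READING. The crux's quantity decays like `L^{-1.0…-1.14}` over `L = 5…129` (prediction `-0.954`;
  j005901 found `-1.0` for `L ≤ 193`), three orders of magnitude above the DCT floor and with no sign of
  a plateau: FreeBoxSparse, FreeBoxPowerSaving with `a ≈ 1`, and the centred forms are all numerically
  robust. `FA₂in(n)/FA₂(B(2n)) ≈ 4` (the inner pairs are the best-connected ones) — constant ratio, as
  §9 requires. SIDE CALIBRATION for the sibling cruxes (not this item): at aspect ratio 2 the number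
  `N_n` of distinct annulus-spanning box-clusters has mean `13.0, 13.6, 13.4, 14.4` for `n = 8, 16, 24, 32`
  (flat within errors: tight, O(1)) but `P(N_n ≤ 3) ≈ 0` — NonProliferation (stmt-4444) is plausible only
  with `M ≈ 20–25`, not the `M = 3` of the route's cheapest-falsifier phrasing (Sen/Shchur count
  side-to-side spanning clusters, a stricter notion); and the annulus was crossed in every one of the 3460
  samples, so the blocking probability `u_n` of SubpolynomialBlocking (stmt-4446) is `≲ 3·10⁻⁴` at these
  sizes (Poisson extrapolation from `E N_n ≈ 13.5`: `u* ~ 10⁻⁶`) — positive in principle, unmeasurable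
  by direct sampling.
-/

/-! ## §5 WHY IT RESISTS — for the provers and the planner

* **No disproof short of the jump.** `jump_of_not_freeBoxSparse`: `¬ crux ⇒ θ(p_c(ℤ³)) > 0`. Nobody
  has a candidate mechanism for a discontinuous transition of nearest-neighbour Bernoulli percolation
  on `ℤ³` (continuity is known for `d = 2` and `d ≥ 11`, tree: `percolationContinuity_two`,
  `FitznerVanDerHofstad2017_beta_eq_one.percolationContinuity`), so no refutation is available, and
  none of the finite/small-model attacks applies: the statement is an `n → ∞` limit at the
  inexplicit parameter `p_c` (definition chain audited: `bondPercolation = setBer(E(ℤ³), p)`,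
  `openConnIn` = reachability in the open graph induced on the box, `box 3 n = [-n,n]³` with
  `card = (2n+1)³ > 0`, `0 < p_c < 1` proved in tree — no junk case).
* **Even a jump need not refute it — and what exactly would.** §2: the bulk twin is equivalent to
  `θ(p_c) = 0`. §8: `FA₂(p, n) ≤ θ(p)² + o(1)` at every `p`, while the route's SpanningPiecesCount
  gives `FA₂(p_c, n) ≳ θ(p_c)²/N_n` on `{N_n ≤ M}` in a jump world. So
  `¬ crux ⇔ (θ(p_c) > 0 ∧ limsup FA₂(p_c,n)/θ(p_c)² > 0)`: a jump whose infinite cluster keeps a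
  non-vanishing fraction of its `θ²|B(n)|²` percolating pairs glued INSIDE the free box. At `p > p_c`
  this gluing holds (Grimmett–Marstrand; not formalised), at `p_c` with `θ > 0` no tool decides it
  (Cerf 2015 calls finite-box LRO at `p_c` "a central question"); in the FK(q ≫ 1) first-order
  world the WIRED critical measure has exactly such in-box giants — the closest existing model of
  `¬ crux`, but there free ≠ wired, whereas Bernoulli has one measure.
* **The crux as a subcritical statement.** §6: `FA₂(p_c, n) = sup_{p<p_c} FA₂(p, n)`, so the crux
  is "`FA₂(p, n) → 0` uniformly in `p < p_c`"; for each fixed `p < p_c` it holds (exponential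
  decay), and the whole content is uniformity as `p ↑ p_c` — equivalently a bound on the free-box
  pair connectivity by a quantity that stays `o(1)` as `ξ(p) → ∞`.
* **Numerics** (§10, MC j007901, L = 5…129 at p = 0.2488126; and j005901 of crux
  FreeSusceptibilityPowerSaving, L ≤ 193): `FA₂(L) ≈ c · L^{-1.0…-1.14}` — decreasing to 0 as predicted
  (`1 + η = 0.954`), three orders above the DCT floor `FA₂ ≥ 1/(768 (n+1)²)` of `FA2_ge` at L = 129 and
  far below any jump ceiling `θ²`; `|K_max|/|B| ∝ L^{-0.51}` (prediction `-0.477`).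
* **What a PROOF must use.** By §2/§8 any proof must exploit the free boundary (it cannot be a
  proof of the bulk statement in disguise, which is the summit). By §4 no argument giving
  `FA₂ = O(n^{-a})` with `a > 2` can be right (and `a ≤ 3` trivially from the diagonal). By §3 the
  argument must fail at `p = 1` (and at every `p > p_c`), so it must use `p ≤ p_c`-specific input.
  By §7 the centred forms (stmt-4644, stmt-5836) are the same item: prove whichever is convenient.
-/

end Summit.CriticalPhenomena.PercolationContinuityZ3.Cruxes.FreeBoxSparse.Disproof

end
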